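import Summits.ResolutionOfSingularities.ResolutionOfSingularities.Theses.WildCones

/-!
# `NarrowRunsDie` (crux stmt-ResolutionOfSingularities-16882, route `WildCones`):
# isolatedness `Isol` is load-bearing — without it the crux is FALSE
# (negative-side support, refuter crux-disprover seat; this file does NOT refute the crux)

`WildCones.NarrowRunsDie` says: for `p` an odd prime, `n ≥ 3`, `κ` perfect of characteristic `p`,
no run `run c₀ i t` of the route's inlined point-blow-up calculus (`clean ∘ tr ∘ dv ∘ bl`) has
ALL states isolated of multiplicity `p` (`Isol ∧ MultP`) AND all states of cleaned order exactly
`p` with one-dimensional cone-invariance space (`OrdP ∧ dL = 1`).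

Here we record, sorry-free and kernel-checked against the VERBATIM `let` calculus, that the
conjunct `Isol` cannot be dropped:

* `narrowRunsDie_false_without_Isol` — the statement obtained from the crux by deleting
  `Isol (run c₀ i t m)` from its first hypothesis (everything else verbatim; the then-unused lets
  `ser/pd/jac/Isol` omitted) is false. Witness: `p = 3`, `n = 3`, `κ = 𝔽₃`, start state the
  single monomial `u₁² u₂` (exponent `![0,2,1]`, coefficient `1`), chart word `i ≡ 0`,
  translation word `t ≡ 0`. The state is a FIXED POINT of the step
  (`u₁²u₂ ↦ u₀³u₁²u₂ ↦ /u₀³ ↦ u₁²u₂`; lemmas `dv_bl_cW`, `tr_zero`, `step_cW`, `run_cW`), it has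
  cleaned order exactly `3` (`multP_cW`, `ordP_cW`), its cone is `X₁² X₂` (`cone_cW`,
  `monomial_A₀`) whose invariance set is `Linv = {w | w₁ = w₂ = 0}` (`linv_cW`: two evaluations
  of the defining identity, at `(X₁,X₂,S) = (1,0,1)` and `(0,1,1)`), so `dL = 1` (`dL_cW`, span =
  `𝔽₃ ∙ e₀`). Hence the constant run is an infinite NARROW run; it is not isolated
  (`∂(u₁²u₂) = (0, 2u₁u₂, u₁²)` dies on the `u₀`-axis — the arc the run follows), exactly as the
  crux predicts.

No definition is introduced: the lemmas are stated over function VARIABLES `clean bl ord dv tr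
step run cone Linv dL` constrained by hypotheses `h* : * = <the route's let body at p = n = 3,
κ = 𝔽₃>`, and the headline proof introduces the crux's `let`s and discharges every `h*` by `rfl`.
The same pattern evaluates the calculus on any other explicit state (e.g. `ConeExit` witnesses,
kill criterion (i) of the route header).

Moral for provers: every proof of `NarrowRunsDie` must use `Isol` — the registered lines
(`Cruxes/NarrowRunsDie/Lines/{birth,derivlift}.lean`) use it at stage `0` only, which this
witness shows is the minimum. Hypotheses NOT load-bearing (disprover's analysis, see
`Cruxes/NarrowRunsDie/Disproof.lean`): `p ≠ 2`, `3 ≤ n`, `PerfectField κ`, `OrdP` (implied by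
`dL = 1 ∧ MultP` for `n ≥ 2`), and `Isol` at stages `m ≥ 1`.
-/

noncomputable section

set_option linter.dupNamespace false

namespace Summit.ResolutionOfSingularities.ResolutionOfSingularities.Theorems.NarrowRunsDie.Negative

open MvPolynomial

/-! ## The witness: `p = 3`, `n = 3`, `κ = 𝔽₃`, `a = u₁² u₂` (variables `u₀ u₁ u₂`, exponent
`![0,2,1]`), chart `0`, translation `0` at every stage -/


/-! Throughout, the witness exponent is `![0, 2, 1] : Fin 3 → ℕ` (the monomial `u₁² u₂`) and the
witness state is `Pi.single ![0, 2, 1] (1 : ZMod 3) : (Fin 3 → ℕ) → ZMod 3` (coefficient `1` there, `0` elsewhere); no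
notation or definition is introduced for them. -/

section Witness

/-! ### The route's `let` calculus at `p = 3`, `n = 3`, `κ = 𝔽₃`, as constrained variables -/

variable (clean : ((Fin 3 → ℕ) → (ZMod 3)) → ((Fin 3 → ℕ) → (ZMod 3)))
  (hclean : clean = fun c A => @ite (ZMod 3) (∀ j, 3 ∣ A j) (Classical.dec _) 0 (c A))
variable (bl : Fin 3 → ((Fin 3 → ℕ) → (ZMod 3)) → ((Fin 3 → ℕ) → (ZMod 3)))
  (hbl : bl = fun i c B => @ite (ZMod 3) (Finset.sum (Finset.univ.erase i) (fun j => B j) ≤ B i)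
    (Classical.dec _) (c (Function.update B i (B i - Finset.sum (Finset.univ.erase i) (fun j => B j)))) 0)
variable (ord : ((Fin 3 → ℕ) → (ZMod 3)) → ℕ)
  (hord : ord = fun c => sInf {m : ℕ | ∃ A, c A ≠ 0 ∧ m = Finset.sum Finset.univ (fun j => A j)})
variable (dv : Fin 3 → ℕ → ((Fin 3 → ℕ) → (ZMod 3)) → ((Fin 3 → ℕ) → (ZMod 3)))
  (hdv : dv = fun i s c B => c (Function.update B i (B i + s)))
variable (tr : Fin 3 → (Fin 3 → (ZMod 3)) → ℕ → ((Fin 3 → ℕ) → (ZMod 3)) → ((Fin 3 → ℕ) → (ZMod 3)))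
  (htr : tr = fun i τ s c B => Finset.sum (Fintype.piFinset (fun _ : Fin 3 => Finset.range (B i + s + 1)))
    (fun D => @ite (ZMod 3) (D i = 0) (Classical.dec _) (c (B + D) * Finset.prod (Finset.univ.erase i)
      (fun j => ((Nat.choose (B j + D j) (B j) : ℕ) : (ZMod 3)) * τ j ^ (D j))) 0))
variable (step : Fin 3 → (Fin 3 → (ZMod 3)) → ((Fin 3 → ℕ) → (ZMod 3)) → ((Fin 3 → ℕ) → (ZMod 3)))
  (hstep : step = fun i τ c => clean (tr i τ (@ite ℕ (3 ≤ ord (clean c)) (Classical.dec _) 3 0)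
    (dv i (@ite ℕ (3 ≤ ord (clean c)) (Classical.dec _) 3 0) (bl i (clean c)))))
variable (run : ((Fin 3 → ℕ) → (ZMod 3)) → (ℕ → Fin 3) → (ℕ → Fin 3 → (ZMod 3)) → ℕ → ((Fin 3 → ℕ) → (ZMod 3)))
  (hrun : run = fun c₀ i t m => @Nat.rec (fun _ => (Fin 3 → ℕ) → (ZMod 3)) c₀ (fun m c => step (i m) (t m) c) m)
variable (cone : ((Fin 3 → ℕ) → (ZMod 3)) → MvPolynomial (Fin 3) (ZMod 3))
  (hcone : cone = fun c => Finset.sum (Fintype.piFinset (fun _ : Fin 3 => Finset.range (3 + 1)))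
    (fun A => @ite (MvPolynomial (Fin 3) (ZMod 3)) (Finset.sum Finset.univ (fun j => A j) = 3) (Classical.dec _)
      (MvPolynomial.monomial (Finsupp.equivFunOnFinite.symm A) (clean c A)) 0))
variable (Linv : ((Fin 3 → ℕ) → (ZMod 3)) → Set (Fin 3 → (ZMod 3)))
  (hLinv : Linv = fun c => {w : Fin 3 → (ZMod 3) | MvPolynomial.aeval (fun j : Fin 3 =>
    (MvPolynomial.X (some j) : MvPolynomial (Option (Fin 3)) (ZMod 3)) + MvPolynomial.C (w j) * MvPolynomial.X none)
      (cone c) = MvPolynomial.rename some (cone c) +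
        MvPolynomial.C (MvPolynomial.eval w (cone c)) * (MvPolynomial.X none) ^ 3})
variable (dL : ((Fin 3 → ℕ) → (ZMod 3)) → ℕ)
  (hdL : dL = fun c => Module.finrank (ZMod 3) (Submodule.span (ZMod 3) (Linv c)))

/-! ### Evaluation of the calculus on the witness -/

/-- the coefficient of `u₁²u₂` is `1` -/
lemma cW_A₀ : (Pi.single (![0, 2, 1] : Fin 3 → ℕ) (1 : ZMod 3) : (Fin 3 → ℕ) → ZMod 3) (![0, 2, 1] : Fin 3 → ℕ) = 1 := Pi.single_eq_same _ _

/-- every other coefficient is `0` -/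
lemma cW_ne (A : Fin 3 → ℕ) (h : A ≠ (![0, 2, 1] : Fin 3 → ℕ)) : (Pi.single (![0, 2, 1] : Fin 3 → ℕ) (1 : ZMod 3) : (Fin 3 → ℕ) → ZMod 3) A = 0 := Pi.single_eq_of_ne h _

/-- support of `cW` is `{A₀}` -/
lemma cW_ne_zero_iff (A : Fin 3 → ℕ) : (Pi.single (![0, 2, 1] : Fin 3 → ℕ) (1 : ZMod 3) : (Fin 3 → ℕ) → ZMod 3) A ≠ 0 ↔ A = (![0, 2, 1] : Fin 3 → ℕ) := by
  by_cases h : A = (![0, 2, 1] : Fin 3 → ℕ)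
  · rw [h, cW_A₀]; simp
  · rw [cW_ne A h]; simp [h]

/-- `u₁²u₂` has degree `3` -/
lemma sum_A₀ : Finset.sum Finset.univ (fun j => (![0, 2, 1] : Fin 3 → ℕ) j) = 3 := by
  simp [Fin.sum_univ_three]

/-- `univ.erase 0 = {1, 2}` in `Fin 3` -/
lemma erase_zero : (Finset.univ.erase (0 : Fin 3)) = {1, 2} := by decide

/-- the off-chart exponent sum in chart `0` -/
lemma sum_erase_zero (B : Fin 3 → ℕ) :
    Finset.sum (Finset.univ.erase (0 : Fin 3)) (fun j => B j) = B 1 + B 2 := by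
  rw [erase_zero, Finset.sum_pair (by decide)]

include hclean in
/-- `cW` is already cleaned (`u₁²u₂` is not a cube) -/
lemma clean_cW : clean (Pi.single (![0, 2, 1] : Fin 3 → ℕ) (1 : ZMod 3) : (Fin 3 → ℕ) → ZMod 3) = (Pi.single (![0, 2, 1] : Fin 3 → ℕ) (1 : ZMod 3) : (Fin 3 → ℕ) → ZMod 3) := by
  rw [hclean]
  funext A
  beta_reduce
  by_cases h : ∀ j, 3 ∣ A j
  · rw [if_pos h]
    have hA : A ≠ (![0, 2, 1] : Fin 3 → ℕ) := by
      rintro rfl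
      have := h 2
      simp at this
    rw [cW_ne A hA]
  · rw [if_neg h]

include hord in
/-- the cleaned order of the witness is `≥ 3` (so the step divides by `u₀³`) -/
lemma ord_cW : 3 ≤ ord (Pi.single (![0, 2, 1] : Fin 3 → ℕ) (1 : ZMod 3) : (Fin 3 → ℕ) → ZMod 3) := by
  rw [hord]
  apply le_csInf
  · exact ⟨3, (![0, 2, 1] : Fin 3 → ℕ), by rw [cW_A₀]; exact one_ne_zero, sum_A₀.symm⟩
  · rintro m ⟨A, hA, rfl⟩
    rw [(cW_ne_zero_iff A).1 hA, sum_A₀]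

include hdv hbl in
/-- blow-up in chart `0` followed by division by `u₀³` fixes `u₁²u₂` -/
lemma dv_bl_cW : dv 0 3 (bl 0 (Pi.single (![0, 2, 1] : Fin 3 → ℕ) (1 : ZMod 3) : (Fin 3 → ℕ) → ZMod 3)) = (Pi.single (![0, 2, 1] : Fin 3 → ℕ) (1 : ZMod 3) : (Fin 3 → ℕ) → ZMod 3) := by
  rw [hdv, hbl]
  funext B
  simp only [sum_erase_zero, Function.update_self, Function.update_idem]
  rw [Function.update_of_ne (by decide : (1 : Fin 3) ≠ 0),
    Function.update_of_ne (by decide : (2 : Fin 3) ≠ 0)]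
  by_cases hB : B = (![0, 2, 1] : Fin 3 → ℕ)
  · subst hB
    have hupd : Function.update (![0, 2, 1] : Fin 3 → ℕ) 0 0 = (![0, 2, 1] : Fin 3 → ℕ) := by funext j; fin_cases j <;> rfl
    simp [hupd]
  · rw [cW_ne B hB]
    by_cases hc : B 1 + B 2 ≤ B 0 + 3
    · rw [if_pos hc]
      apply cW_ne
      intro hU
      apply hB
      have h1 : B 1 = 2 := by
        have := congrFun hU 1; rw [Function.update_of_ne (by decide)] at this; simpa using this
      have h2 : B 2 = 1 := by
        have := congrFun hU 2; rw [Function.update_of_ne (by decide)] at this; simpa using this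
      have h0 : B 0 = 0 := by
        have := congrFun hU 0; rw [Function.update_self] at this; simp at this; omega
      funext j; fin_cases j <;> simp [h0, h1, h2]
    · rw [if_neg hc]

include htr in
/-- translation by `0` is the identity on every state -/
lemma tr_zero (c : (Fin 3 → ℕ) → (ZMod 3)) : tr 0 (fun _ => 0) 3 c = c := by
  rw [htr]
  funext B
  beta_reduce
  rw [Finset.sum_eq_single (0 : Fin 3 → ℕ)]
  · simp
  · intro D _ hD
    by_cases hD0 : D 0 = 0
    · rw [if_pos hD0]
      have : D 1 ≠ 0 ∨ D 2 ≠ 0 := by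
        by_contra hcon
        push Not at hcon
        apply hD; funext j; fin_cases j <;> simp [hD0, hcon.1, hcon.2]
      rw [erase_zero, Finset.prod_pair (by decide)]
      rcases this with h | h <;> simp [h]
    · rw [if_neg hD0]
  · intro h
    exact absurd (Fintype.mem_piFinset.mpr fun _ => by simp) h

include hclean hbl hord hdv htr hstep in
/-- the witness is a FIXED POINT of the step (chart `0`, translation `0`) -/
lemma step_cW : step 0 (fun _ => 0) (Pi.single (![0, 2, 1] : Fin 3 → ℕ) (1 : ZMod 3) : (Fin 3 → ℕ) → ZMod 3) = (Pi.single (![0, 2, 1] : Fin 3 → ℕ) (1 : ZMod 3) : (Fin 3 → ℕ) → ZMod 3) := by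
  rw [hstep]
  beta_reduce
  rw [clean_cW clean hclean, if_pos (ord_cW ord hord), dv_bl_cW bl hbl dv hdv, tr_zero tr htr,
    clean_cW clean hclean]

include hclean hbl hord hdv htr hstep hrun in
/-- hence the run is constant -/
lemma run_cW (m : ℕ) : run (Pi.single (![0, 2, 1] : Fin 3 → ℕ) (1 : ZMod 3) : (Fin 3 → ℕ) → ZMod 3) (fun _ => 0) (fun _ _ => 0) m = (Pi.single (![0, 2, 1] : Fin 3 → ℕ) (1 : ZMod 3) : (Fin 3 → ℕ) → ZMod 3) := by
  induction m with
  | zero => rw [hrun]; rfl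
  | succ m ih =>
    have : run (Pi.single (![0, 2, 1] : Fin 3 → ℕ) (1 : ZMod 3) : (Fin 3 → ℕ) → ZMod 3) (fun _ => 0) (fun _ _ => 0) (m + 1) =
        step 0 (fun _ => 0) (run (Pi.single (![0, 2, 1] : Fin 3 → ℕ) (1 : ZMod 3) : (Fin 3 → ℕ) → ZMod 3) (fun _ => 0) (fun _ _ => 0) m) := by
      rw [hrun]
    rw [this, ih, step_cW clean hclean bl hbl ord hord dv hdv tr htr step hstep]

include hclean in
/-- `MultP` holds at the witness (inlined: cleaned, non-zero, all degrees `≥ 3`) -/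
lemma multP_cW : (∃ A, clean (Pi.single (![0, 2, 1] : Fin 3 → ℕ) (1 : ZMod 3) : (Fin 3 → ℕ) → ZMod 3) A ≠ 0) ∧
    ∀ A, clean (Pi.single (![0, 2, 1] : Fin 3 → ℕ) (1 : ZMod 3) : (Fin 3 → ℕ) → ZMod 3) A ≠ 0 → 3 ≤ Finset.sum Finset.univ (fun j => A j) := by
  rw [clean_cW clean hclean]
  refine ⟨⟨(![0, 2, 1] : Fin 3 → ℕ), by rw [cW_A₀]; exact one_ne_zero⟩, fun A hA => ?_⟩
  rw [(cW_ne_zero_iff A).1 hA, sum_A₀]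

include hclean in
/-- `OrdP` holds at the witness (inlined: a cleaned monomial of degree exactly `3`) -/
lemma ordP_cW : ∃ A, clean (Pi.single (![0, 2, 1] : Fin 3 → ℕ) (1 : ZMod 3) : (Fin 3 → ℕ) → ZMod 3) A ≠ 0 ∧ Finset.sum Finset.univ (fun j => A j) = 3 := by
  rw [clean_cW clean hclean]
  exact ⟨(![0, 2, 1] : Fin 3 → ℕ), by rw [cW_A₀]; exact one_ne_zero, sum_A₀⟩

/-- `A₀` is in the exponent box of the cone sum -/
lemma A₀_mem : (![0, 2, 1] : Fin 3 → ℕ) ∈ Fintype.piFinset (fun _ : Fin 3 => Finset.range (3 + 1)) := by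
  rw [Fintype.mem_piFinset]; intro j; fin_cases j <;> simp

include hclean hcone in
/-- the cone of the witness is the single monomial `u₁²u₂` -/
lemma cone_cW : cone (Pi.single (![0, 2, 1] : Fin 3 → ℕ) (1 : ZMod 3) : (Fin 3 → ℕ) → ZMod 3) = MvPolynomial.monomial (Finsupp.equivFunOnFinite.symm (![0, 2, 1] : Fin 3 → ℕ)) 1 := by
  rw [hcone]
  beta_reduce
  rw [clean_cW clean hclean, Finset.sum_eq_single (![0, 2, 1] : Fin 3 → ℕ)]
  · rw [if_pos sum_A₀, cW_A₀]
  · intro A _ hA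
    rw [cW_ne A hA, MvPolynomial.monomial_zero, ite_self]
  · intro h; exact absurd A₀_mem h

/-- … i.e. `X 1 ^ 2 * X 2` -/
lemma monomial_A₀ : MvPolynomial.monomial (Finsupp.equivFunOnFinite.symm (![0, 2, 1] : Fin 3 → ℕ)) (1 : (ZMod 3))
    = (X 1 : MvPolynomial (Fin 3) (ZMod 3)) ^ 2 * X 2 := by
  rw [MvPolynomial.monomial_eq, Finsupp.prod_fintype _ _ (fun i => pow_zero _)]
  simp [Fin.prod_univ_three]

include hclean hcone hLinv in
/-- the cone-invariance set of the witness is `{w | w 1 = 0 ∧ w 2 = 0}` (⊆: evaluate the defining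
identity at `(X₁, X₂, S) = (1, 0, 1)` and `(0, 1, 1)`; ⊇: direct) -/
lemma linv_cW : Linv (Pi.single (![0, 2, 1] : Fin 3 → ℕ) (1 : ZMod 3) : (Fin 3 → ℕ) → ZMod 3) = {w | w 1 = 0 ∧ w 2 = 0} := by
  rw [hLinv]
  ext w
  simp only [Set.mem_setOf_eq, cone_cW clean hclean cone hcone, monomial_A₀, map_mul, map_pow,
    MvPolynomial.aeval_X, MvPolynomial.rename_X, MvPolynomial.eval_X]
  constructor
  · intro h
    have e1 := congr_arg (MvPolynomial.eval (fun o : Option (Fin 3) => o.elim (1 : (ZMod 3)) ![0, 1, 0])) h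
    have e2 := congr_arg (MvPolynomial.eval (fun o : Option (Fin 3) => o.elim (1 : (ZMod 3)) ![0, 0, 1])) h
    simp only [map_add, map_mul, map_pow, MvPolynomial.eval_X, MvPolynomial.eval_C, Option.elim_none,
      Option.elim_some, Matrix.cons_val_zero, Matrix.cons_val_one, Matrix.head_cons, Matrix.cons_val_two,
      Matrix.tail_cons] at e1 e2
    have hw1 : w 1 ^ 2 = 0 := by linear_combination e2
    have hw1' : w 1 = 0 := (pow_eq_zero_iff (n := 2) (by norm_num)).mp hw1
    have hw2 : w 2 = 0 := by linear_combination e1 - 2 * w 2 * hw1'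
    exact ⟨hw1', hw2⟩
  · rintro ⟨h1, h2⟩
    simp [h1, h2]

include hclean hcone hLinv in
/-- its span is the line `𝔽₃ ∙ e₀` -/
lemma span_linv_cW : Submodule.span (ZMod 3) (Linv (Pi.single (![0, 2, 1] : Fin 3 → ℕ) (1 : ZMod 3) : (Fin 3 → ℕ) → ZMod 3)) = (ZMod 3) ∙ (Pi.single 0 1 : Fin 3 → (ZMod 3)) := by
  rw [linv_cW clean hclean cone hcone Linv hLinv]
  apply le_antisymm
  · rw [Submodule.span_le]
    rintro w ⟨h1, h2⟩
    have hw : w = w 0 • (Pi.single 0 1 : Fin 3 → (ZMod 3)) := by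
      funext j; fin_cases j <;> simp [h1, h2]
    rw [hw]
    exact Submodule.smul_mem _ _ (Submodule.subset_span rfl)
  · rw [Submodule.span_le]
    rintro w hw
    rw [Set.mem_singleton_iff] at hw
    subst hw
    exact Submodule.subset_span (by simp)

include hclean hcone hLinv hdL in
/-- so `dL = 1` at the witness -/
lemma dL_cW : dL (Pi.single (![0, 2, 1] : Fin 3 → ℕ) (1 : ZMod 3) : (Fin 3 → ℕ) → ZMod 3) = 1 := by
  rw [hdL]
  beta_reduce
  rw [span_linv_cW clean hclean cone hcone Linv hLinv]
  exact finrank_span_singleton (by simp)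

end Witness

/-! ## The headline negative lemma -/

/-- **`Isol` is load-bearing in `WildCones.NarrowRunsDie`.** Dropping the isolatedness conjunct
`Isol (run c₀ i t m)` from the first hypothesis of the crux (keeping everything else VERBATIM:
the inlined `clean/bl/ord/dv/tr/step/run` calculus, `MultP`, `OrdP`, `cone`, `Linv`, `dL`, and
the binder restrictions `p` odd prime, `3 ≤ n`, `κ` perfect of characteristic `p`; the now unused
lets `ser/pd/jac/Isol` are omitted) gives a FALSE statement: over `𝔽₃` with `n = 3`, the state
`a = u₁² u₂` (one monomial, exponent `![0,2,1]`) is a fixed point of the step in chart `0` with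
translation `0` (`u₁² u₂ ↦ u₀³ u₁² u₂ / u₀³`), it has cleaned order exactly `3`, its
cone-invariance set is `Linv = {w | w₁ = w₂ = 0}` (so `dL = 1`, the forced direction being `e₀`),
and the constant run satisfies `MultP ∧ OrdP ∧ dL = 1` at every stage — an infinite narrow run.
It is not isolated (`∂a = (0, 2u₁u₂, u₁²)` vanishes on the `u₀`-axis, the arc the run follows),
as the crux predicts. Moral for provers: any proof must use `Isol` (the registered lines use it at
stage `0` only). This does NOT refute the crux. [folklore] -/
theorem narrowRunsDie_false_without_Isol :
    ¬ (∀ p : ℕ, p.Prime → p ≠ 2 → ∀ n : ℕ, 3 ≤ n → ∀ (κ : Type) [Field κ] [CharP κ p] [PerfectField κ] (c₀ : (Fin n → ℕ) → κ) (i : ℕ → Fin n) (t : ℕ → Fin n → κ), let clean : ((Fin n → ℕ) → κ) → ((Fin n → ℕ) → κ) := fun c A => @ite κ (∀ j, p ∣ A j) (Classical.dec _) 0 (c A); let bl : Fin n → ((Fin n → ℕ) → κ) → ((Fin n → ℕ) → κ) := fun i c B => @ite κ (Finset.sum (Finset.univ.erase i) (fun j => B j) ≤ B i) (Classical.dec _)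 (c (Function.update B i (B i - Finset.sum (Finset.univ.erase i) (fun j => B j)))) 0; let ord : ((Fin n → ℕ) → κ) → ℕ := fun c => sInf {m : ℕ | ∃ A, c A ≠ 0 ∧ m = Finset.sum Finset.univ (fun j => A j)}; let dv : Fin n → ℕ → ((Fin n → ℕ) → κ) → ((Fin n → ℕ) → κ) := fun i s c B => c (Function.update B i (B i + s)); let tr : Fin n → (Fin n → κ) → ℕ → ((Fin n → ℕ) → κ) → ((Fin n → ℕ) → κ) := fun i τ s c B => Finset.sum (Fintype.piFinset (fun _ : Fin n => Finset.range (B i + s + 1))) (fun D => @ite κ (D i = 0) (Classical.dec _) (c (B + D) * Finset.prod (Finset.univ.erase i) (fun j => ((Nat.choose (B j + D j) (B j) : ℕ) : κ) * τ j ^ (D j))) 0); let step : Fin n → (Fin n → κ) → ((Fin n → ℕ) → κ) → ((Fin n → ℕ) → κ) := fun i τ c => clean (tr i τ (@ite ℕ (p ≤ ord (clean c)) (Classical.dec _) p 0) (dv i (@ite ℕ (p ≤ ord (clean c)) (Classical.dec _) p 0) (bl i (clean c)))); let run : ((Fin n → ℕ) → κ) → (ℕ → Fin n) → (ℕ → Fin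 n → κ) → ℕ → ((Fin n → ℕ) → κ) := fun c₀ i t m => @Nat.rec (fun _ => (Fin n → ℕ) → κ) c₀ (fun m c => step (i m) (t m) c) m; let MultP : ((Fin n → ℕ) → κ) → Prop := fun c => (∃ A, clean c A ≠ 0) ∧ ∀ A, clean c A ≠ 0 → p ≤ Finset.sum Finset.univ (fun j => A j); let OrdP : ((Fin n → ℕ) → κ) → Prop := fun c => ∃ A, clean c A ≠ 0 ∧ Finset.sum Finset.univ (fun j => A j) = p; let cone : ((Fin n → ℕ) → κ) → MvPolynomial (Fin n) κ := fun c => Finset.sum (Fintype.piFinset (fun _ : Fin n => Finset.range (p + 1))) (fun A => @ite (MvPolynomial (Fin n) κ) (Finset.sum Finset.univ (fun j => A j) = p) (Classical.dec _) (MvPolynomial.monomial (Finsupp.equivFunOnFinite.symm A) (clean c A)) 0); let Linv : ((Fin n → ℕ) → κ) → Set (Fin n → κ) := fun c => {w : Fin n → κ | MvPolynomial.aeval (fun j : Fin n => (MvPolynomial.X (some j) : MvPolynomial (Option (Fin n)) κ) + MvPolynomial.C (w j) * MvPolynomial.X none) (cone c) = MvPolynomial.rename some (cone c) + MvPolynomial.C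 (MvPolynomial.eval w (cone c)) * (MvPolynomial.X none) ^ p}; let dL : ((Fin n → ℕ) → κ) → ℕ := fun c => Module.finrank κ (Submodule.span κ (Linv c)); (∀ m, MultP (run c₀ i t m)) → (∀ m, OrdP (run c₀ i t m) ∧ dL (run c₀ i t m) = 1) → False) := by
  intro h
  have key : ∀ (cW' : (Fin 3 → ℕ) → (ZMod 3)), cW' = (Pi.single (![0, 2, 1] : Fin 3 → ℕ) (1 : ZMod 3) : (Fin 3 → ℕ) → ZMod 3) →
      let clean : ((Fin 3 → ℕ) → (ZMod 3)) → ((Fin 3 → ℕ) → (ZMod 3)) := fun c A => @ite (ZMod 3) (∀ j, 3 ∣ A j) (Classical.dec _) 0 (c A); let bl : Fin 3 → ((Fin 3 → ℕ) → (ZMod 3)) → ((Fin 3 → ℕ) → (ZMod 3)) := fun i c B => @ite (ZMod 3) (Finset.sum (Finset.univ.erase i) (fun j => B j) ≤ B i) (Classical.dec _) (c (Function.update B i (B i - Finset.sum (Finset.univ.erase i) (fun j => B j)))) 0; let ord : ((Fin 3 → ℕ) → (ZMod 3)) → ℕ := fun c => sInf {m : ℕ | ∃ A, c A ≠ 0 ∧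 m = Finset.sum Finset.univ (fun j => A j)}; let dv : Fin 3 → ℕ → ((Fin 3 → ℕ) → (ZMod 3)) → ((Fin 3 → ℕ) → (ZMod 3)) := fun i s c B => c (Function.update B i (B i + s)); let tr : Fin 3 → (Fin 3 → (ZMod 3)) → ℕ → ((Fin 3 → ℕ) → (ZMod 3)) → ((Fin 3 → ℕ) → (ZMod 3)) := fun i τ s c B => Finset.sum (Fintype.piFinset (fun _ : Fin 3 => Finset.range (B i + s + 1))) (fun D => @ite (ZMod 3) (D i = 0) (Classical.dec _) (c (B + D) * Finset.prod (Finset.univ.erase i) (fun j => ((Nat.choose (B j + D j) (B j) : ℕ) : (ZMod 3)) * τ j ^ (D j))) 0); let step : Fin 3 → (Fin 3 → (ZMod 3)) → ((Fin 3 → ℕ) → (ZMod 3)) → ((Fin 3 → ℕ) → (ZMod 3)) := fun i τ c => clean (tr i τ (@ite ℕ (3 ≤ ord (clean c)) (Classical.dec _) 3 0) (dv i (@ite ℕ (3 ≤ ord (clean c)) (Classical.dec _) 3 0) (bl i (clean c)))); let run : ((Fin 3 → ℕ) → (ZMod 3)) → (ℕ → Fin 3) → (ℕ → Fin 3 → (ZMod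 3)) → ℕ → ((Fin 3 → ℕ) → (ZMod 3)) := fun c₀ i t m => @Nat.rec (fun _ => (Fin 3 → ℕ) → (ZMod 3)) c₀ (fun m c => step (i m) (t m) c) m; let MultP : ((Fin 3 → ℕ) → (ZMod 3)) → Prop := fun c => (∃ A, clean c A ≠ 0) ∧ ∀ A, clean c A ≠ 0 → 3 ≤ Finset.sum Finset.univ (fun j => A j); let OrdP : ((Fin 3 → ℕ) → (ZMod 3)) → Prop := fun c => ∃ A, clean c A ≠ 0 ∧ Finset.sum Finset.univ (fun j => A j) = 3; let cone : ((Fin 3 → ℕ) → (ZMod 3)) → MvPolynomial (Fin 3) (ZMod 3) := fun c => Finset.sum (Fintype.piFinset (fun _ : Fin 3 => Finset.range (3 + 1))) (fun A => @ite (MvPolynomial (Fin 3) (ZMod 3)) (Finset.sum Finset.univ (fun j => A j) = 3) (Classical.dec _) (MvPolynomial.monomial (Finsupp.equivFunOnFinite.symm A) (clean c A)) 0); let Linv : ((Fin 3 → ℕ) → (ZMod 3)) → Set (Fin 3 → (ZMod 3)) := fun c => {w : Fin 3 → (ZMod 3) | MvPolynomial.aeval (fun j : Fin 3 => (MvPolynomial.X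 (some j) : MvPolynomial (Option (Fin 3)) (ZMod 3)) + MvPolynomial.C (w j) * MvPolynomial.X none) (cone c) = MvPolynomial.rename some (cone c) + MvPolynomial.C (MvPolynomial.eval w (cone c)) * (MvPolynomial.X none) ^ 3}; let dL : ((Fin 3 → ℕ) → (ZMod 3)) → ℕ := fun c => Module.finrank (ZMod 3) (Submodule.span (ZMod 3) (Linv c)); (∀ m, MultP (run cW' (fun _ => 0) (fun _ _ => 0) m)) ∧ (∀ m, OrdP (run cW' (fun _ => 0) (fun _ _ => 0) m) ∧ dL (run cW' (fun _ => 0) (fun _ _ => 0) m) = 1) := by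
    intro cW' hc clean bl ord dv tr step run MultP OrdP cone Linv dL
    subst hc
    have hr : ∀ m, run (Pi.single (![0, 2, 1] : Fin 3 → ℕ) (1 : ZMod 3) : (Fin 3 → ℕ) → ZMod 3) (fun _ => 0) (fun _ _ => 0) m = (Pi.single (![0, 2, 1] : Fin 3 → ℕ) (1 : ZMod 3) : (Fin 3 → ℕ) → ZMod 3) :=
      run_cW clean rfl bl rfl ord rfl dv rfl tr rfl step rfl run rfl
    refine ⟨fun m => ?_, fun m => ⟨?_, ?_⟩⟩
    · rw [hr m]
      exact multP_cW clean rfl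
    · rw [hr m]
      exact ordP_cW clean rfl
    · rw [hr m]
      exact dL_cW clean rfl cone rfl Linv rfl dL rfl
  have k := key _ rfl
  exact h 3 Nat.prime_three (by decide) 3 le_rfl (ZMod 3) (Pi.single (![0, 2, 1] : Fin 3 → ℕ) (1 : ZMod 3) : (Fin 3 → ℕ) → ZMod 3) (fun _ => 0) (fun _ _ => 0) k.1 k.2

end Summit.ResolutionOfSingularities.ResolutionOfSingularities.Theorems.NarrowRunsDie.Negative

end
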